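import Literature.MathematicalPhysics.QuantumFieldTheory.Balaban1983to89.B9BackgroundsKLevelV1
import Literature.MathematicalPhysics.QuantumFieldTheory.Balaban1983to89.Node00.N03IndexOddL

/-!
# `Balaban1983to89.B9PinMembersKLevelV1` — Stage-3′(Y) GEOMETRY∕INDEX layer, MODULE 3: the MEMBER type of the [B9] family index («(torus, k, {Ω_j}, M) for fixed
# d, L», p. 399) with the SECOND sequence {Ω′_j} of Theorem 3.14 and the Sect.-E datum Λ of Theorem 3.15, the member's geometry `geo9Y` (dag-n03-b's `geo9K`)
# and backgrounds `bg9Y` (MODULE 2's `bg9K`, regular for BOTH sequences), the diagonal members, and the vacuity guards (inhabited; `M` unbounded)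

B9 = T. Bałaban, *Propagators for lattice gauge theories in a background field*, Commun. Math. Phys. **99** (1985) 389–434 [Balaban1985BackgroundPropagators];
[4] = [Balaban1984PropagatorsII].  pub-ymgap Track A, node N06; seat `pub-ymgap-dag-n06-a` g3 = «def-Y» (director-ym LINE №32, rails (i)–(vi)).  Design note
`HOME/pub-ymgap-dag-n06-a/B9-PIN-DESIGN-g2.md` §2 («ONE rich member type carrying both sequences»), §9 (the absolute floor `M ≥ M*`).  DEFINITIONS + guards;
nothing of [B9]'s estimates asserted; count-neutral; NO stage predicate ∕ `Admissible` ∕ `Record` (node00-def's «3′ after ₉» order is not pre-empted).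

WHAT IS PRINTED.  p. 399: the constants of Thms 3.1–3.3 depend on `d, L` only — the family ranges over tori, `k`, sequences `{Ω_j}` satisfying [4] (2.1)–(2.4)
with `M`, `R` «sufficiently large»; Thm 3.14 pp. 426–427: «a pair of operators constructed for the two sequences {Ω_j}, {Ω′_j}» (same torus, `Ω = Ω_k ∩ Ω′_k`);
Thm 3.15 p. 432: `C^{(k)}(Λ)` for «Λ ⊂ Λ_k a union of big blocks» far from `Λ_kᶜ` (p. 429: distances `> RM`).

WHAT IS DEFINED ∕ PROVED HERE.
* §1 `MemberY d ℓ hd hL b₀ b₁ Mstar` EXTENDS the k-level V1 index `B6KLevelCensusIndexV1.KIdx` (torus, `k`, `{Ω_j} = D`, `M = L·M_h`, `R`, weights) by: `hcfk`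
  (print's units `c_f = Lᵏ`, = `Node00.KRIdx`), `hMstar : Mstar ≤ L·M_h` (the absolute floor, `Mstar` a `(d, L)`-level PARAMETER), the second sequence
  `D′ : TDomains …` ON THE SAME TORUS with its four V1 accessories (`hpl′`, `w′`, `hw′`, `hwb′` — the `KIdx` fields that read `D`, duplicated), and the Sect.-E
  datum `Λ : Set T_η` with `hΛlev` (`Λ ⊂ Bᵏ(Λ_k)`), `hΛblocks` (a union of big `k`-blocks), `hΛsep` (torus distance from `Λ` to `Λ_kᶜ` `> R·M·Lᵏ` fine units).
  `MemberY.snd : KIdx` = the same member with `D ↦ D′` (same fine-site type DEFINITIONALLY); `MemberY.diag i …` = the diagonal member `D′ := D`, `Λ := ∅`;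
  `snd_diag`, `toKIdx_diag` (`rfl`).
* §2 `geo9Y x := B9GeoNormsKLevelV1.geo9K x.toKIdx`; `bg9Y 𝔸 G x :=` MODULE 2's `bg9K 𝔸 G x.toKIdx` with the (3.35)∕(3.36) fields REPLACED by the conjunction
  for BOTH sequences (TYPING CHOICE Q-Y2 of INBOX [DEFY-G3-DECL-LIST-1]: one `bg9` per member serves all leaf fields and Thm 3.14's difference needs `U` regular
  for both sequences; print's one-sequence statements are EXACTLY the diagonal members: `bg9Y_diag`); unfoldings `geo9Y_M`, `reg335Y_iff`; the `U = 1` facts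
  `reg335Y_one`, `reg336Y_one`, `cplx337Y_one` (from MODULE 2).
* §3 GUARDS (vacuity standard Q-N00-6; ∃ only over genuine data): `memberY_exists_M_ge` — at every odd `L ≥ 5` (`4 ≤ ℓ`), `k ≥ 2`, band `0 < b₀ ≤ b₁`, and every
  real `M₂`, a member with nominal index `k` and `M₂ ≤ M` (n03-a's `Node00.N03IndexOddL.kRIdx_nonvacuous_oddL`, diagonal, `Λ = ∅`); hence `memberY_nonempty`
  and `memberY_unbounded_M`.  `Λ = ∅` is an honest member (Thm 3.15 vacuous THERE, not over the index) — Q-Y3 of the decl list; the MANDATORY companion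
  (ref-A's rail-(iv) read, INBOX [REFA-G5-DECL-LIST-1-READ]) is **`memberY_exists_nonempty_Λ`**: at `L = 5` (`ℓ = 4`) a member with `Λ ≠ ∅` for every `k ≥ 2`,
  `M₂` — over `kIdx_topConst_L5`, a k-level member WITH FULL TOP LEVEL (`Ω_k = T_η`), available exactly where the V1 chart places top cubes
  (`B6CubeWindowV1.placed_top`, `L ≤ 5`; n03-a's located caveat (c7)); at odd `L ≥ 7` the tree's members have empty top territory — LOCATED, not hidden.
  Also `bg9Y_diag_eq` (ref-A's condition on Q-Y2: at a diagonal member the backgrounds ARE MODULE 2's carrier, field-wise).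
HONEST SCOPE: index∕carrier plumbing; no operator defined; one finite lattice programme; NOT continuum ∕ OS ∕ mass gap ∕ Clay.
-/

noncomputable section

namespace Literature.MathematicalPhysics.QuantumFieldTheory.Balaban1983to89.B9PinMembersKLevelV1

open B4Reflection242 (boxDom blk)
open B4TorusKernel.MultiPeriod (torusSupNorm)
open B6MultiLevelBoxOperator (bigSide N0)
open B6MultiLevelTorusOperator (TDomains)
open B6SectAOperatorsV1 (BondIdx)
open B6CubeWindowV1 (Placed GlobalBand placed_top)
open B6Cover236MultiLevelBlocks (cubes)
open B6KLevelCensusIndexV1 (KIdx kGeo)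
open B6GlobalChartV1 (PV toBox domT)
open B6KLevelFamilyWitnessOddLV1 (exists_const_TDomains)
open B6KLevelFamilyWitnessV1 (N0_V1_pow globalBand_witness exists_exponent)
open B9GeoNormsKLevelV1 (geo9K)
open B9BackgroundsKLevelV1 (torusCube levV1 CfgV1 bg9K)

variable (d ℓ : ℕ) (hd : 1 ≤ d + 1) (hL : Odd (ℓ + 1) ∧ 1 < ℓ + 1) (b₀ b₁ : ℝ) (Mstar : ℕ)

/-! ## §1 The member type -/

/-- **A MEMBER OF THE [B9] FAMILY INDEX at Stage 3′(Y)** («(torus, k, {Ω_j}, M) for fixed d, L», p. 399): a k-level V1 member `KIdx` in print's units `c_f = Lᵏ`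
with the absolute floor `Mstar ≤ M = L·M_h`, a SECOND nested sequence `{Ω′_j} = D′` on the same torus (Thm 3.14) with its V1 accessories, and the Sect.-E datum
`Λ ⊂ Bᵏ(Λ_k)`, a union of big `k`-blocks with torus distance to `Λ_kᶜ` greater than `R·M·Lᵏ` fine units (Thm 3.15).
[cite: Balaban1985BackgroundPropagators, Thm 3.1 p.397 + p.399 (the family), Thm 3.14 pp.426–427 (two sequences), Thm 3.15 (3.185)–(3.187) p.432 (Λ)] -/
structure MemberY extends KIdx d ℓ hd hL b₀ b₁ where
  hcfk : cf = (((ℓ + 1 : ℕ) : ℝ)) ^ k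
  hMstar : Mstar ≤ (ℓ + 1) * Mh
  D' : TDomains d ℓ Mh k P' R
  hpl' : ∀ c : ↥(cubes D'.toDomains), Placed ℓ k P' c.1
  w' : BondIdx (domT hN D' hk) → ℝ
  hw' : ∀ b, 0 < w' b
  hwb' : GlobalBand b₀ b₁ cf w'
  Λ : Set (Site (PV d ℓ m K hd hL) 0)
  hΛlev : ∀ x ∈ Λ, D.lev (toBox hN x).1 = k
  hΛblocks : ∀ x x' : Site (PV d ℓ m K hd hL) 0,
    blk (bigSide ℓ Mh k) (toBox hN x').1 = blk (bigSide ℓ Mh k) (toBox hN x).1 → (x ∈ Λ ↔ x' ∈ Λ)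
  hΛsep : ∀ x ∈ Λ, ∀ x' : Site (PV d ℓ m K hd hL) 0, D.lev (toBox hN x').1 < k →
    ((R * bigSide ℓ Mh k : ℕ) : ℝ) < torusSupNorm (N0 ℓ Mh k P') ((toBox hN x).1 - (toBox hN x').1)

namespace MemberY

variable {d ℓ hd hL b₀ b₁ Mstar}

/-- **the member of the SECOND sequence**: the same torus, `k`, `M`, `R`, units and band, with `{Ω_j} ↦ {Ω′_j}` (so its fine-site type is the member's,
definitionally). [cite: Balaban1985BackgroundPropagators, Thm 3.14 pp.426–427 («the two sequences {Ω_j}, {Ω′_j}»)] -/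
def snd (x : MemberY d ℓ hd hL b₀ b₁ Mstar) : KIdx d ℓ hd hL b₀ b₁ :=
  { x.toKIdx with D := x.D', hpl := x.hpl', w := x.w', hw := x.hw', hwb := x.hwb' }

/-- the second member lives in print's units too. [cite: Balaban1984PropagatorsII, (2.1) p.224 («η = L^{−k}»)] -/
theorem snd_cf (x : MemberY d ℓ hd hL b₀ b₁ Mstar) : x.snd.cf = (((ℓ + 1 : ℕ) : ℝ)) ^ x.snd.k := x.hcfk

/-- **THE DIAGONAL MEMBER** over a k-level member `i` in print's units above the floor: `{Ω′_j} := {Ω_j}`, `Λ := ∅` — print's one-sequence statements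
(Thms 3.1–3.13) are read at these members. [cite: Balaban1985BackgroundPropagators, p.399 (the one-sequence family)] -/
def diag (i : KIdx d ℓ hd hL b₀ b₁) (hcf : i.cf = (((ℓ + 1 : ℕ) : ℝ)) ^ i.k) (hM : Mstar ≤ (ℓ + 1) * i.Mh) :
    MemberY d ℓ hd hL b₀ b₁ Mstar where
  toKIdx := i
  hcfk := hcf
  hMstar := hM
  D' := i.D
  hpl' := i.hpl
  w' := i.w
  hw' := i.hw
  hwb' := i.hwb
  Λ := ∅
  hΛlev := fun _ h => h.elim
  hΛblocks := fun _ _ _ => by simp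
  hΛsep := fun _ h => h.elim

/-- the diagonal member projects to `i`. [cite: Balaban1985BackgroundPropagators, p.399 (bookkeeping)] -/
theorem toKIdx_diag (i : KIdx d ℓ hd hL b₀ b₁) (hcf : i.cf = (((ℓ + 1 : ℕ) : ℝ)) ^ i.k) (hM : Mstar ≤ (ℓ + 1) * i.Mh) :
    (diag i hcf hM : MemberY d ℓ hd hL b₀ b₁ Mstar).toKIdx = i := rfl

/-- … and its second member is `i` again. [cite: Balaban1985BackgroundPropagators, p.399 (bookkeeping)] -/
theorem snd_diag (i : KIdx d ℓ hd hL b₀ b₁) (hcf : i.cf = (((ℓ + 1 : ℕ) : ℝ)) ^ i.k) (hM : Mstar ≤ (ℓ + 1) * i.Mh) :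
    (diag i hcf hM : MemberY d ℓ hd hL b₀ b₁ Mstar).snd = i := rfl

/-- the Sect.-E datum of the diagonal member is empty. [cite: Balaban1985BackgroundPropagators, Thm 3.15 p.432 (bookkeeping)] -/
theorem Λ_diag (i : KIdx d ℓ hd hL b₀ b₁) (hcf : i.cf = (((ℓ + 1 : ℕ) : ℝ)) ^ i.k) (hM : Mstar ≤ (ℓ + 1) * i.Mh) :
    (diag i hcf hM : MemberY d ℓ hd hL b₀ b₁ Mstar).Λ = ∅ := rfl

end MemberY

/-! ## §2 Geometry and backgrounds of a member -/

variable {d ℓ hd hL b₀ b₁ Mstar}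

/-- **the geometry of a member**: dag-n03-b's reading `geo9K` of `Node00.kGeoU` at the member's k-level index. [cite: Balaban1985BackgroundPropagators, Sect. A (3.39)–(3.41) pp.396–397] -/
def geo9Y (x : MemberY d ℓ hd hL b₀ b₁ Mstar) : B9.Geometry := geo9K x.toKIdx

/-- `(geo9Y x).M = L·M_h`. [cite: Balaban1984PropagatorsII, (2.1) p.224 (bookkeeping)] -/
theorem geo9Y_M (x : MemberY d ℓ hd hL b₀ b₁ Mstar) : (geo9Y x).M = ((ℓ + 1 : ℕ) : ℝ) * (x.Mh : ℝ) := rfl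

/-- the absolute floor at a member: `Mstar ≤ (geo9Y x).M`. [cite: Balaban1985BackgroundPropagators, p.426 («M and R sufficiently large»; design §9)] -/
theorem mstar_le_M (x : MemberY d ℓ hd hL b₀ b₁ Mstar) : (Mstar : ℝ) ≤ (geo9Y x).M := by
  rw [geo9Y_M]
  exact_mod_cast x.hMstar

section Backgrounds

variable (𝔸 : Type) [NormedRing 𝔸] [NormedAlgebra ℂ 𝔸] [CompleteSpace 𝔸] (G : Subgroup 𝔸ˣ)

/-- **the backgrounds of a member**: MODULE 2's carrier at the member's index, with the classes (3.35)∕(3.36) taken for BOTH sequences `{Ω_j}`, `{Ω′_j}`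
(typing choice Q-Y2; the diagonal members recover the one-sequence classes, `bg9Y_reg335_diag`). [cite: Balaban1985BackgroundPropagators, (3.35)–(3.38) p.396, Thm 3.14 pp.426–427] -/
def bg9Y (x : MemberY d ℓ hd hL b₀ b₁ Mstar) : B9.Backgrounds :=
  { bg9K 𝔸 G x.toKIdx with
    Reg335 := fun c α₀ U => (bg9K 𝔸 G x.toKIdx).Reg335 c α₀ U ∧ (bg9K 𝔸 G x.snd).Reg335 c α₀ U
    Reg336 := fun c α₀ U => (bg9K 𝔸 G x.toKIdx).Reg336 c α₀ U ∧ (bg9K 𝔸 G x.snd).Reg336 c α₀ U }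

variable {𝔸 G}

/-- configurations of a member are the torus gauge fields of MODULE 2. [cite: Balaban1985BackgroundPropagators, Sect. A p.390 (bookkeeping)] -/
theorem bg9Y_Cfg (x : MemberY d ℓ hd hL b₀ b₁ Mstar) : (bg9Y 𝔸 G x).Cfg = CfgV1 (PV d ℓ x.m x.K hd hL) 𝔸 := rfl

/-- the (3.35) field of a member, unfolded: regular for `{Ω_j}` AND for `{Ω′_j}`. [cite: Balaban1985BackgroundPropagators, (3.35) p.396, Thm 3.14 pp.426–427] -/
theorem reg335Y_iff (x : MemberY d ℓ hd hL b₀ b₁ Mstar) (c α₀ : ℝ) (U : CfgV1 (PV d ℓ x.m x.K hd hL) 𝔸) :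
    (bg9Y 𝔸 G x).Reg335 c α₀ U ↔ (bg9K 𝔸 G x.toKIdx).Reg335 c α₀ U ∧ (bg9K 𝔸 G x.snd).Reg335 c α₀ U :=
  Iff.rfl

/-- the (3.36) field of a member, unfolded. [cite: Balaban1985BackgroundPropagators, (3.36) p.396] -/
theorem reg336Y_iff (x : MemberY d ℓ hd hL b₀ b₁ Mstar) (c α₀ : ℝ) (U : CfgV1 (PV d ℓ x.m x.K hd hL) 𝔸) :
    (bg9Y 𝔸 G x).Reg336 c α₀ U ↔ (bg9K 𝔸 G x.toKIdx).Reg336 c α₀ U ∧ (bg9K 𝔸 G x.snd).Reg336 c α₀ U :=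
  Iff.rfl

/-- the (3.37) field of a member is MODULE 2's (relative to `{Ω_j}`). [cite: Balaban1985BackgroundPropagators, (3.37) p.396] -/
theorem cplx337Y_iff (x : MemberY d ℓ hd hL b₀ b₁ Mstar) (α₁ : ℝ) (U U' : CfgV1 (PV d ℓ x.m x.K hd hL) 𝔸) :
    (bg9Y 𝔸 G x).Cplx337 α₁ U U' ↔ (bg9K 𝔸 G x.toKIdx).Cplx337 α₁ U U' :=
  Iff.rfl

/-- **at a DIAGONAL member the (3.35) field is the one-sequence class** of MODULE 2. [cite: Balaban1985BackgroundPropagators, (3.35) p.396 (bookkeeping: print's one-sequence statements live at the diagonal)] -/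
theorem bg9Y_reg335_diag (i : KIdx d ℓ hd hL b₀ b₁) (hcf : i.cf = (((ℓ + 1 : ℕ) : ℝ)) ^ i.k) (hM : Mstar ≤ (ℓ + 1) * i.Mh)
    (c α₀ : ℝ) (U : CfgV1 (PV d ℓ i.m i.K hd hL) 𝔸) :
    (bg9Y 𝔸 G (MemberY.diag i hcf hM : MemberY d ℓ hd hL b₀ b₁ Mstar)).Reg335 c α₀ U ↔ (bg9K 𝔸 G i).Reg335 c α₀ U :=
  and_self_iff

/-- **at a DIAGONAL member the backgrounds ARE MODULE 2's one-sequence carrier** (field-wise; `R ∧ R = R` by `propext`). [cite: Balaban1985BackgroundPropagators, (3.35)–(3.38) p.396 (bookkeeping: the one-sequence carriers live at the diagonal)] -/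
theorem bg9Y_diag_eq (i : KIdx d ℓ hd hL b₀ b₁) (hcf : i.cf = (((ℓ + 1 : ℕ) : ℝ)) ^ i.k) (hM : Mstar ≤ (ℓ + 1) * i.Mh) :
    bg9Y 𝔸 G (MemberY.diag i hcf hM : MemberY d ℓ hd hL b₀ b₁ Mstar) = bg9K 𝔸 G i := by
  simp only [bg9Y, MemberY.toKIdx_diag, MemberY.snd_diag, and_self]

/-- (3.36) implies (3.35) at a member. [cite: Balaban1985BackgroundPropagators, p.396 (after (3.36))] -/
theorem reg336Y_reg335Y (x : MemberY d ℓ hd hL b₀ b₁ Mstar) {c α₀ : ℝ} {U : CfgV1 (PV d ℓ x.m x.K hd hL) 𝔸}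
    (h : (bg9Y 𝔸 G x).Reg336 c α₀ U) : (bg9Y 𝔸 G x).Reg335 c α₀ U :=
  ⟨B9BackgroundsKLevelV1.reg336_reg335 _ h.1, B9BackgroundsKLevelV1.reg336_reg335 _ h.2⟩

/-- **`U ≡ 1` is in the class (3.35)–(3.36) of every member** (both sequences). [cite: Balaban1985BackgroundPropagators, Cor. 3.5 p.407 («U = 1»)] -/
theorem reg336Y_one [NormOneClass 𝔸] (x : MemberY d ℓ hd hL b₀ b₁ Mstar) {c α₀ : ℝ} (hc : 0 < c) (hα : 0 < α₀) :
    (bg9Y 𝔸 G x).Reg336 c α₀ (bg9Y 𝔸 G x).one :=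
  ⟨B9BackgroundsKLevelV1.reg336_one _ hc hα, B9BackgroundsKLevelV1.reg336_one _ hc hα⟩

/-- **`U ≡ 1` is in the class (3.35) of every member** — the knit's `hone` at Stage 3′(Y). [cite: Balaban1985BackgroundPropagators, Cor. 3.5 p.407 («U = 1»)] -/
theorem reg335Y_one [NormOneClass 𝔸] (x : MemberY d ℓ hd hL b₀ b₁ Mstar) {c α₀ : ℝ} (hc : 0 < c) (hα : 0 < α₀) :
    (bg9Y 𝔸 G x).Reg335 c α₀ (bg9Y 𝔸 G x).one :=
  reg336Y_reg335Y x (reg336Y_one x hc hα)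

/-- the trivial perturbation is in the class (3.37) of every member. [cite: Balaban1985BackgroundPropagators, (3.37) p.396] -/
theorem cplx337Y_one (x : MemberY d ℓ hd hL b₀ b₁ Mstar) {α₁ : ℝ} (hα : 0 < α₁) (U : CfgV1 (PV d ℓ x.m x.K hd hL) 𝔸) :
    (bg9Y 𝔸 G x).Cplx337 α₁ U (bg9Y 𝔸 G x).one :=
  B9BackgroundsKLevelV1.cplx337_one (G := G) _ hα U

end Backgrounds

/-! ## §3 Guards: the member type is inhabited with `M` beyond every threshold -/

/-- **INHABITED BEYOND EVERY THRESHOLD**: at every odd `L ≥ 5` (`4 ≤ ℓ`), every `k ≥ 2`, every band `0 < b₀ ≤ b₁` and every real `M₂`, there is a member with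
nominal index `k` and `M₂ ≤ M` (the diagonal member over n03-a's k-level witness `Node00.N03IndexOddL.kRIdx_nonvacuous_oddL`, `Λ = ∅`).
[cite: Balaban1984PropagatorsII, (2.1)–(2.4) p.224, Prop. 2.2 p.234 («M is sufficiently large»); Balaban1985BackgroundPropagators, p.399 (the family)] -/
theorem memberY_exists_M_ge (hℓ : 4 ≤ ℓ) {k : ℕ} (hk : 2 ≤ k) (hb₀ : 0 < b₀) (hb₁ : b₀ ≤ b₁) (M₂ : ℝ) :
    ∃ x : MemberY d ℓ hd hL b₀ b₁ Mstar, x.k = k ∧ M₂ ≤ (geo9Y x).M := by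
  obtain ⟨i, hik, hM, -⟩ :=
    Node00.kRIdx_nonvacuous_oddL d ℓ k hd hL hℓ hk (max M₂ (Mstar : ℝ)) 0 hb₀ hb₁
  have hMstar : Mstar ≤ (ℓ + 1) * i.1.Mh := by
    have h : (Mstar : ℝ) ≤ ((ℓ + 1 : ℕ) : ℝ) * (i.1.Mh : ℝ) := (le_max_right _ _).trans hM
    exact_mod_cast h
  exact ⟨MemberY.diag i.1 i.2 hMstar, hik, (le_max_left _ _).trans hM⟩

/-- the member type is non-empty (odd `L ≥ 5`, band `0 < b₀ ≤ b₁`). [cite: Balaban1985BackgroundPropagators, p.399 (the family is inhabited)] -/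
theorem memberY_nonempty (hℓ : 4 ≤ ℓ) (hb₀ : 0 < b₀) (hb₁ : b₀ ≤ b₁) : Nonempty (MemberY d ℓ hd hL b₀ b₁ Mstar) := by
  obtain ⟨x, -, -⟩ := memberY_exists_M_ge (d := d) (hd := hd) (hL := hL) (Mstar := Mstar) hℓ (le_refl 2) hb₀ hb₁ 0
  exact ⟨x⟩

/-- **`M` IS UNBOUNDED over the members**: every leaf's threshold «∃ M₁ ∀ i, M₁ ≤ M_i → …» binds non-vacuously at Stage 3′(Y).
[cite: Balaban1985BackgroundPropagators, Thm 3.1 p.397 («for M ≥ M₁»; the thresholds bite)] -/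
theorem memberY_unbounded_M (hℓ : 4 ≤ ℓ) (hb₀ : 0 < b₀) (hb₁ : b₀ ≤ b₁) (M₂ : ℝ) :
    ∃ x : MemberY d ℓ hd hL b₀ b₁ Mstar, M₂ ≤ (geo9Y x).M := by
  obtain ⟨x, -, hM⟩ := memberY_exists_M_ge (d := d) (hd := hd) (hL := hL) (Mstar := Mstar) hℓ (le_refl 2) hb₀ hb₁ M₂
  exact ⟨x, hM⟩

/-- **A k-LEVEL MEMBER WITH FULL TOP LEVEL AT `L = 5`** (`ℓ = 4`): for every `k ≥ 2`, band `0 < b₀ ≤ b₁` and real `M₂`, a member `i : KIdx` in print's units with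
`i.k = k`, `M₂ ≤ M` and `Ω_k = T_η` (`lev ≡ k`: [4] p. 224 «we admit the case when some domains Ω_j are equal to T_η»).  The top cubes are placed by
`B6CubeWindowV1.placed_top`, which the V1 chart lineage has ONLY for `L ≤ 5` (n03-a's located caveat (c7) of the N03 count line; `KIdx` itself needs
`L ≥ 5`) — so `L = 5` is the one size at which the tree places top-level cubes today; LOCATED, not hidden.  Construction = `kIdx_nonvacuous_oddL`'s
(`M_h = Lᵃ`, `P′ = R = 2L²`, `m = k + a + 3`, `K = 0`, band weights rescaled to `c_f = Lᵏ`) with the constant-`k` family.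
[cite: Balaban1984PropagatorsII, (2.1)–(2.4) p.224, (2.16) p.225 (the member's data); Balaban1985BackgroundPropagators, p.399 (the family)] -/
theorem kIdx_topConst_L5 (hℓ : 4 ≤ ℓ) (hℓ4 : ℓ ≤ 4) {k : ℕ} (hk : 2 ≤ k) (hb₀ : 0 < b₀) (hb₁ : b₀ ≤ b₁) (M₂ : ℝ) :
    ∃ i : KIdx d ℓ hd hL b₀ b₁, i.k = k ∧ i.cf = (((ℓ + 1 : ℕ) : ℝ)) ^ i.k ∧ M₂ ≤ (kGeo i).M ∧ ∀ x, i.D.lev x = k := by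
  obtain ⟨a, h8, hM₂, -⟩ := exists_exponent ℓ (by omega) M₂ 0 (2 * (ℓ + 1) ^ 2) (by nlinarith)
  set P' : Fin (d + 1) → ℕ := fun _ => 2 * (ℓ + 1) ^ 2 with hP'
  have hP5 : ∀ μ : Fin (d + 1), 5 ≤ P' μ := fun μ => by simp only [hP']; nlinarith
  have hP12 : ∀ μ : Fin (d + 1), 2 * (ℓ + 1) + 2 ≤ P' μ := fun μ => by simp only [hP']; nlinarith
  have hN : ∀ μ, N0 ℓ ((ℓ + 1) ^ a) k P' μ = (PV d ℓ (k + a + 3) 0 hd hL).sitesPerDir 0 :=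
    fun μ => N0_V1_pow ℓ k a 2 (k + a + 3) 0 hd hL (by ring) μ
  have hk' : k ≤ k + a + 3 + 0 := by omega
  obtain ⟨D, hD⟩ := exists_const_TDomains d ℓ ((ℓ + 1) ^ a) k P' (2 * (ℓ + 1) ^ 2) (j := k) (by omega) le_rfl
  have hpl : ∀ c : ↥(cubes D.toDomains), Placed ℓ k P' c.1 := by
    intro c
    obtain ⟨x, _, hx⟩ := Finset.mem_image.1 c.2
    refine placed_top hℓ4 hP12 c.1 ?_
    have h1 : c.1.1 = D.lev x := (congrArg Prod.fst hx).symm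
    rw [h1]
    exact hD x
  obtain ⟨w, hw, hwb⟩ := globalBand_witness (domT hN D hk') hb₀ hb₁
  set cf : ℝ := (((ℓ + 1 : ℕ) : ℝ)) ^ k with hcfdef
  have hcf : cf ≠ 0 := by positivity
  have hwb' : GlobalBand b₀ b₁ cf (fun i => cf ^ 2 * w i) := by
    intro i
    obtain ⟨h1, h2⟩ := hwb i
    have key : cf ^ 2 * w i / (cf / (((ℓ + 1 : ℕ) : ℝ)) ^ (i.1.1 : ℕ)) ^ 2 = w i / (1 / (((ℓ + 1 : ℕ) : ℝ)) ^ (i.1.1 : ℕ)) ^ 2 := by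
      field_simp
    dsimp only
    rw [key]
    exact ⟨h1, h2⟩
  refine ⟨⟨k + a + 3, 0, (ℓ + 1) ^ a, k, 2 * (ℓ + 1) ^ 2, a, P', hN, D, hk', hk, rfl, h8, le_rfl, hP5, hℓ, hpl,
    cf, hcf, fun i => cf ^ 2 * w i, fun i => mul_pos (by positivity) (hw i), hwb'⟩,
    rfl, rfl, ?_, hD⟩
  show M₂ ≤ (((ℓ + 1 : ℕ) : ℝ)) * ((((ℓ + 1) ^ a : ℕ)) : ℝ)
  have hcast : (((ℓ + 1 : ℕ) : ℝ)) = (ℓ : ℝ) + 1 := by push_cast; ring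
  rw [hcast]
  exact hM₂

/-- **GUARD (ref-A rail (iv), mandatory): A MEMBER WITH NON-EMPTY Sect.-E DATUM `Λ`** — at `L = 5` (`ℓ = 4`), every `k ≥ 2`, band `0 < b₀ ≤ b₁` and real `M₂`: the
diagonal member over `kIdx_topConst_L5` (`Ω_k = T_η`, so `Λ_kᶜ = ∅` and the separation clause is void) with `Λ :=` the big `k`-block of the origin.  Hence the
Thm 3.15 leaf field is NOT inhabited over the member type by `Λ = ∅` alone.  Other odd `L ≥ 7`: members exist (`memberY_exists_M_ge`) but the tree's V1
chart does not place top cubes there (`placed_top ⇔ L ≤ 5`), so their top territory is empty and so is every admissible `Λ` — LOCATED (n03-a (c7)).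
[cite: Balaban1985BackgroundPropagators, Thm 3.15 p.432 («Λ ⊂ Λ_k a union of big blocks»; non-vacuity of the typed datum)] -/
theorem memberY_exists_nonempty_Λ (hℓ : 4 ≤ ℓ) (hℓ4 : ℓ ≤ 4) {k : ℕ} (hk : 2 ≤ k) (hb₀ : 0 < b₀) (hb₁ : b₀ ≤ b₁) (M₂ : ℝ) :
    ∃ x : MemberY d ℓ hd hL b₀ b₁ Mstar, x.k = k ∧ M₂ ≤ (geo9Y x).M ∧ x.Λ.Nonempty := by
  obtain ⟨i, hik, hcf, hM, hlev⟩ := kIdx_topConst_L5 (d := d) (hd := hd) (hL := hL) hℓ hℓ4 hk hb₀ hb₁ (max M₂ (Mstar : ℝ))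
  have hMstar : Mstar ≤ (ℓ + 1) * i.Mh := by
    have h : (Mstar : ℝ) ≤ ((ℓ + 1 : ℕ) : ℝ) * (i.Mh : ℝ) := (le_max_right _ _).trans hM
    exact_mod_cast h
  have hlev' : ∀ x, i.D.lev x = i.k := fun x => (hlev x).trans hik.symm
  refine ⟨{ toKIdx := i, hcfk := hcf, hMstar := hMstar, D' := i.D, hpl' := i.hpl, w' := i.w, hw' := i.hw, hwb' := i.hwb,
            Λ := {x | blk (bigSide ℓ i.Mh i.k) (toBox i.hN x).1 = blk (bigSide ℓ i.Mh i.k) (toBox i.hN default).1},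
            hΛlev := fun x _ => hlev' _,
            hΛblocks := fun x x' h => ?_,
            hΛsep := fun x _ x' h => absurd h (by rw [hlev']; exact lt_irrefl _) }, hik, (le_max_left _ _).trans hM, ⟨default, rfl⟩⟩
  simp only [Set.mem_setOf_eq, h]

end Literature.MathematicalPhysics.QuantumFieldTheory.Balaban1983to89.B9PinMembersKLevelV1

end
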